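import Literature.MathematicalPhysics.QuantumFieldTheory.Balaban1983to89.T4PersistenceGrove

/-!
# `Balaban1983to89.T4RenewalChains` — THE MULTIPLICATIVE RENEWAL-CHAIN MODEL: the lineage's carrier chain
Grove ledger → `ForestDom` → `EventDom` → `RelWeightBound` INHABITED END TO END, the two raw clauses holding with
equality (cell `pub-balaban`, node U5c / spine estimate NE7b, RENEWAL member; journal CLAIM T4-U5c.E-NE7b-PROVE-P2e* — a
self-row under T4-DAG §8 Q24(a) —, unit b2b-balaban-t4-ne7b-p2 gen 5, the lineage of `T4PersistenceRenewal` /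
`T4PersistenceGrove`; companion record `t4/T4-EST-NE7b-P2.md` v2.6; imports `…T4PersistenceGrove` ONLY and modifies
nothing)

HONEST FRAMING (cell `pub-balaban`, T4-DAG PAGE 1).  The cell's T4 target is the existence AND uniqueness of the
`ε → 0` limit of Bałaban's unit-scale block-averaged expectations on a FIXED finite four-torus ([Balaban1988Convergent]
Cor. 3 p. 264, [Balaban1989LargeFieldII] Thm 1 p. 355 are ultraviolet STABILITY only) — NOT infinite volume, NOT a mass
gap, NOT the Clay problem.  This module is [folklore] finite combinatorics and real arithmetic on a TOY FAMILY (zero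
`sorry`, zero cite-tagged hypothesis, no `def … : Prop` fact of Bałaban's); it uses NONE of the cell's conditionals
(BetaPertH, (B), (B^μ)).  B16 = [Balaban1989LargeFieldII] is a manuscript UNDER AUDIT; the two page pointers below repeat
LOCATIONS already fixed by the lineage's headers (`…T4PersistenceRenewal` §6, `…T4PersistenceDictionary` (L1)/(L2)) and
identify what the toy MODELS — nothing of B16 is asserted, used, or estimated here.  Value = a kernel certificate that the
lineage's typed missing inequality is CONSISTENT and NON-VACUOUS and that its constructors compose as designed; NOT an
estimate, NOT summit progress, and NOT evidence about Bałaban's family (1.104) p. 391 either way.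

WHAT THIS IS.  `…T4HistoryPeeling` §5 inhabited the single-slot carrier `SlotDom` by the independent-structure model
(`slotDom_product`: one on/off flag per slot, equality in each fibre).  One level down, the renewal member's carriers —
`T4PersistenceRenewal.ForestDom` (per insertion fibre: an event forest, a renewal kernel with its column generating
condition, a root budget, the terminal bookkeeping) and `EventDom` (per `(K, t)`: a switch-off structure, OLD birth
scales `< j⋆(K)`, the R4 count, a `ForestDom` on EVERY fibre with `K`-UNIFORM constants), reached through the ledger
constructor `T4PersistenceGrove.forestDom_of_grove_raw` (LEDGER `hroot`/`hstep`/`hpend` + CATALOGUE + the two RAW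
relative prices (E2-rel-raw) `hraw₀`, (PR-raw) `hraw` = cell gap G-ne7bp2-1) — had no inhabitant: each is a hypothesis
shape with a dozen interlocking clauses (quantifier order, horizons `K − j i`, ages, windows, tilts `Λ < z < z₁`), and a
carrier nobody can inhabit may be vacuous or contradictory as typed.  This module inhabits ALL of them at once by the
simplest family with genuine persistence:
* §1 RENEWAL CHAINS of one slot with window `R` and horizon `Ah`: histories `S ⊆ [1, Ah]` of renewal AGES, LINKED
  (`Linked R S`: every renewal comes at most `R` steps after the previous event — the toy form of «K = R_{j+1} for Z»
  p. 386 as located by the dictionary's rule (L2)), top age `topAge S`, truncation `trunc S` (the last renewal undone; a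
  chain again, `linked_trunc`; strictly earlier, `topAge_trunc_lt`), the PENDING chains `pendChains R Ah`
  (`Ah < topAge S + R`: alive across the horizon).  Chains have unbounded length as `Ah → ∞`.
* §2 THE LEDGER REALISATION: the genealogy `gen j S` of a chain born at step `j` (the dictionary's `Gen.born 0 j` renewed
  at the steps `j + a`, `a ∈ S`), its reach `j + topAge S + R` under the constant window table `cW R` (`reach_gen`), and
  `step_trunc` — A LINKED RENEWAL IS A LEDGER STEP: the grove of `S` arises from the grove of `trunc S` by ONE
  `T4PersistenceGrove.Step.renew` at step `j + topAge S`, admissible exactly because the chain is linked.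
* §3 THE CHAIN FOREST `chainForest R Ah emb hist` inside any term type `ι` (embedding `emb` of histories with left
  inverse `hist`) — an `EventForest` with root = the bare birth, `last` = top age, `parent` = truncation — and
  `forestDom_chains`: for weights `w (emb S) ≤ p₀·p^{#S}·a₀` (MULTIPLICATIVE prices: `p₀` for the birth, `p` per renewal,
  relative to the context weight `a₀`), tilts `1 ≤ z < z₁`, ANY root budget `B₀ ≥ p₀·z₁^R` and ANY defect `η` with
  `p·z₁^R·((z/z₁)/(1 − z/z₁)) ≤ 1 − η`:  `ForestDom (emb '' pendChains R Ah) w a₀ Ah z η B₀ (1/(1 − z₁⁻¹z))` — obtained BY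
  `forestDom_of_grove_raw` with every one of its hypotheses discharged on the model: one shape, catalogue price
  `p·z₁^R`, own booking `R`, no tail, and (E2-rel-raw) / (PR-raw) WITH EQUALITY (`chainPrice_eq_mul_trunc`: one renewal
  more costs exactly the factor `p`).
* §4 THE RUN: `N` persistent slots, slot `i` born at scale `i` and ALIVE at every cutoff `K` with `i < j⋆(K) = ⌊K/2⌋`
  (horizon `K − i → ∞`); terms `terms N R K` = assignments to the `N` coordinates of `none` or (alive slots) a pending
  chain; the OPTION-PRODUCT switch-off structure `runSwitchOff` (pending = the coordinate carries a chain, switch-off =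
  forget it; the four `SwitchOff` axioms); multiplicative weights `runWeight a p₀ p K τ = a K·∏ optPrice` with the
  two raw clauses as EQUALITIES in the run (`runWeight_raw_root`: the bare birth costs exactly `p₀` times the context
  weight; `runWeight_raw_step`: one renewal more costs exactly `p` times the truncated history's weight);
  `fibre_eq` — the insertion fibre over a context IS the set of pending chains —; `eventDom_run` — `EventDom l₀ (terms N R)
  (runWeight a p₀ p) Bad z η B₀ D 1 Λ j⋆` for every `Λ ≥ 1` (R4 count: one slot per birth scale) —; and
  `relWeightBound_run` — two multiplicative runs (prices `(p₀, p)`, `(q₀, q)`) on the same family under a common `B₀` and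
  a common POSITIVE defect give the row's output shape `T4WeightBudget.RelWeightBound` by the lineage's
  `relWeightBound_of_eventDom`, profile `W K = 1 − exp(−(B₀D/η)·(Λz⁻¹)^{K − ⌊K/2⌋ + 1}/(1 − Λz⁻¹))`.
* §5 SANITY, decided: the seven chains / five pending chains for `R = 2`, `Ah = 3`; window `1` forces a renewal at
  every step (`pendChains 1 4 = {{1, 2, 3, 4}}`: persistence = activity at every step); and ONE NUMERICAL INSTANCE OF EVERY
  HYPOTHESIS AT ONCE (`Λ = 2 < z = 4 < z₁ = 8`, `R = 1`, prices `1/64`, `B₀ = 1/8`, `η = 7/8`) — the hypotheses of the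
  end-to-end theorem are jointly satisfiable.
THE ONLY INEQUALITIES THE MODEL CONSUMES are the tilt ordering `Λ < z < z₁` and the PAIRING CONDITION
`p·z₁^R·(z/z₁)/(1 − z/z₁) < 1` — per-renewal price against the tilt raised to the OWN window —, the toy form of the
node's «p₀(g)/N > 4 log L·(1 + o(1))» (T4-DAG U5c; `T4PersistenceRenewal.rate_window_iff`: with `Λ = e^{4 log L}`,
`z₁ = e^{κ₁}` the rate condition reads `4 log L < κ₁`).

WHAT THIS SAYS ABOUT THE WALL (records level, no claim about B16).  In the model the two raw clauses hold with equality
BECAUSE the weight of a history is a product over slots and over events (`runWeight_update_some`,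
`chainPrice_eq_mul_trunc`): inserting a component, or one more event, multiplies the weight by a context-free factor.  In
Bałaban's inductive representation (1.104) p. 391 the weight of a large-field history is an integral whose integrand
couples the components (small-field action, boundary terms, the ℝ-operations near each component); the printed factors
((1.79) p. 383, the renewal factor p. 386) bound ONE operation along ONE sequence of operations and are spent there
(record `t4/T4-EST-NE7b-P2.md` §3–§4, census v12).  Cell gap G-ne7bp2-1 is therefore located, in the model's language,
as exactly the failure of multiplicativity: a CONTEXT-UNIFORM bound on the ratio `weight(history with the event) /
weight(truncated history)` inside the positive weights of (1.104).  This module neither narrows nor widens that gap.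

WHERE THE MODEL IS POORER THAN THE LEDGER (flagged): no mergers (`Step.merge`, the deferred window (L3), groves of
several trees are never produced — the model is the pure-renewal sub-ledger, as the dictionary's `pairKernel_live_renew`);
one slot per birth scale and at most `N` slots ever (the R4 count is met with `V = 1`; anchor-cell multiplicities
`Λ^{K − j₀}` are not modelled); constant windows `R` (B14's scale-dependent `R_j` and the three-valued window creep of
`T4PersistenceRenewal` §7 are not exercised); weights independent of `t`.  None of this bears on the certificate's purpose.

v1.0.1 (gen 6 of the row, 2026-08-19) — DOCSTRING-ONLY, every declaration byte-identical to v1 (p187309): the §5 toy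
docstring on `pendChains 1 4` no longer attributes a window status to B16 p. 361 (GAPS G-t4r2-17, referee-b2b-balaban-t4-ref2
pass 11).  No theorem consumed the sentence.
-/

open Finset

namespace Literature.MathematicalPhysics.QuantumFieldTheory.Balaban1983to89.T4RenewalChains

open Literature.MathematicalPhysics.QuantumFieldTheory.Balaban1983to89
open T4WeightBudget T4HistoryPeeling T4PersistenceRenewal T4PersistenceDictionary T4PersistenceGrove

/-! ## §1 Renewal chains of one slot: ages, truncation, the linking (gap) condition -/

section Chains

/-- The TOP AGE of a renewal history `S` (a finite set of renewal ages): its largest element, `0` for the bare birth.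
[folklore] -/
def topAge (S : Finset ℕ) : ℕ := S.sup id

/-- every age is at most the top age [folklore] -/
theorem le_topAge {S : Finset ℕ} {a : ℕ} (h : a ∈ S) : a ≤ topAge S := Finset.le_sup (f := id) h

/-- the top age is bounded by any common bound of the ages [folklore] -/
theorem topAge_le {S : Finset ℕ} {m : ℕ} (h : ∀ a ∈ S, a ≤ m) : topAge S ≤ m := Finset.sup_le h

/-- the bare birth has top age `0` [folklore] -/
@[simp] theorem topAge_empty : topAge ∅ = 0 := by simp [topAge]

/-- a non-empty history attains its top age [folklore] -/
theorem topAge_mem {S : Finset ℕ} (h : S.Nonempty) : topAge S ∈ S := by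
  obtain ⟨a, ha, h'⟩ := Finset.exists_mem_eq_sup S h id
  rw [topAge, h']; exact ha

/-- The TRUNCATION of a history: its last renewal undone. [folklore] -/
def trunc (S : Finset ℕ) : Finset ℕ := S.erase (topAge S)

/-- the ages below the top age are the truncation [folklore] -/
theorem filter_lt_topAge {S : Finset ℕ} : S.filter (fun b => b < topAge S) = trunc S := by
  ext b
  simp only [Finset.mem_filter, trunc, Finset.mem_erase]
  constructor
  · rintro ⟨hb, hlt⟩; exact ⟨hlt.ne, hb⟩
  · rintro ⟨hne, hb⟩; exact ⟨hb, lt_of_le_of_ne (le_topAge hb) hne⟩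

/-- truncation strictly lowers the top age of a non-empty history of POSITIVE ages [folklore] -/
theorem topAge_trunc_lt {S : Finset ℕ} (h : S.Nonempty) (h1 : ∀ a ∈ S, 1 ≤ a) : topAge (trunc S) < topAge S := by
  have htop : 1 ≤ topAge S := (h1 _ (topAge_mem h)).trans le_rfl
  have : topAge (trunc S) ≤ topAge S - 1 := by
    refine topAge_le fun b hb => ?_
    rw [trunc, Finset.mem_erase] at hb
    have := lt_of_le_of_ne (le_topAge hb.2) hb.1
    omega
  omega

/-- a non-empty history is its truncation with the top age re-inserted [folklore] -/
theorem insert_trunc {S : Finset ℕ} (h : S.Nonempty) : insert (topAge S) (trunc S) = S :=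
  Finset.insert_erase (topAge_mem h)

/-- the truncation has one renewal fewer [folklore] -/
theorem card_trunc_add_one {S : Finset ℕ} (h : S.Nonempty) : (trunc S).card + 1 = S.card :=
  Finset.card_erase_add_one (topAge_mem h)

/-- **THE LINKING CONDITION** with window `R`: every renewal age `a ∈ S` comes at most `R` steps after the previous
event (the largest earlier age, or the birth at age `0`) — the history is a RENEWAL CHAIN whose gaps are `≤ R`, i.e.
each renewal happens while the component is still pending from the previous event. [folklore] -/
def Linked (R : ℕ) (S : Finset ℕ) : Prop := ∀ a ∈ S, a ≤ topAge (S.filter fun b => b < a) + R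

/-- the linking condition is decidable (a bounded quantifier over the history) [folklore] -/
instance Linked.decidablePred (R : ℕ) : DecidablePred (Linked R) := fun S => by unfold Linked; infer_instance

/-- the bare birth is a chain [folklore] -/
theorem linked_empty (R : ℕ) : Linked R ∅ := fun _ ha => by simp at ha

/-- the truncation of a chain is a chain [folklore] -/
theorem linked_trunc {R : ℕ} {S : Finset ℕ} (h : Linked R S) : Linked R (trunc S) := by
  intro a ha
  have haS : a ∈ S := (Finset.mem_erase.1 ha).2
  have hset : (trunc S).filter (fun b => b < a) = S.filter fun b => b < a := by
    ext b
    simp only [trunc, Finset.mem_filter, Finset.mem_erase]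
    constructor
    · rintro ⟨⟨-, hb⟩, hlt⟩; exact ⟨hb, hlt⟩
    · rintro ⟨hb, hlt⟩; exact ⟨⟨(lt_of_lt_of_le hlt (le_topAge haS)).ne, hb⟩, hlt⟩
  rw [hset]; exact h a haS

/-- in a non-empty chain the last renewal comes at most `R` steps after the previous event [folklore] -/
theorem Linked.topAge_le {R : ℕ} {S : Finset ℕ} (h : Linked R S) (hne : S.Nonempty) :
    topAge S ≤ topAge (trunc S) + R := by
  have := h _ (topAge_mem hne)
  rwa [filter_lt_topAge] at this

/-- **THE RENEWAL CHAINS OF ONE SLOT WITH HORIZON `Ah`**: histories of positive renewal ages `≤ Ah` linked with window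
`R`. [folklore] -/
def chains (R Ah : ℕ) : Finset (Finset ℕ) := (Finset.Icc 1 Ah).powerset.filter (Linked R)

/-- **THE PENDING CHAINS**: those still pending at the horizon — the last event's window reaches beyond `Ah`. [folklore] -/
def pendChains (R Ah : ℕ) : Finset (Finset ℕ) := (chains R Ah).filter fun S => Ah < topAge S + R

/-- membership in the chain family [folklore] -/
theorem mem_chains {R Ah : ℕ} {S : Finset ℕ} : S ∈ chains R Ah ↔ S ⊆ Finset.Icc 1 Ah ∧ Linked R S := by
  simp [chains]

/-- membership in the pending chains [folklore] -/
theorem mem_pendChains {R Ah : ℕ} {S : Finset ℕ} :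
    S ∈ pendChains R Ah ↔ S ∈ chains R Ah ∧ Ah < topAge S + R := by
  simp [pendChains]

/-- pending chains are chains [folklore] -/
theorem pendChains_subset (R Ah : ℕ) : pendChains R Ah ⊆ chains R Ah := Finset.filter_subset _ _

/-- the bare birth is a chain [folklore] -/
theorem empty_mem_chains (R Ah : ℕ) : ∅ ∈ chains R Ah := mem_chains.2 ⟨Finset.empty_subset _, linked_empty R⟩

/-- ages of a chain are positive [folklore] -/
theorem one_le_of_mem_chains {R Ah : ℕ} {S : Finset ℕ} (h : S ∈ chains R Ah) : ∀ a ∈ S, 1 ≤ a :=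
  fun _ ha => (Finset.mem_Icc.1 ((mem_chains.1 h).1 ha)).1

/-- ages of a chain are within the horizon [folklore] -/
theorem topAge_le_of_mem_chains {R Ah : ℕ} {S : Finset ℕ} (h : S ∈ chains R Ah) : topAge S ≤ Ah :=
  topAge_le fun _ ha => (Finset.mem_Icc.1 ((mem_chains.1 h).1 ha)).2

/-- the chain family is closed under truncation [folklore] -/
theorem trunc_mem_chains {R Ah : ℕ} {S : Finset ℕ} (h : S ∈ chains R Ah) : trunc S ∈ chains R Ah :=
  mem_chains.2 ⟨(Finset.erase_subset _ _).trans (mem_chains.1 h).1, linked_trunc (mem_chains.1 h).2⟩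

end Chains

/-! ## §2 The ledger realisation: a chain is a script of renewals of the dictionary's genealogy -/

section Ledger

/-- The CONSTANT WINDOW TABLE: every event (birth `0`, renewal at age `a`) keeps the component pending for `R` more
steps. [folklore] -/
def cW (R : ℕ) : ℕ → ℕ := fun _ => R

/-- the genealogy of a history, by recursion on the number of renewals (fuel `n`) [folklore] -/
def genN (j : ℕ) : ℕ → Finset ℕ → Gen ℕ
  | 0, _ => Gen.born 0 j
  | n + 1, S => if S.Nonempty then Gen.renew (genN j n (trunc S)) (topAge S) (j + topAge S - 1) else Gen.born 0 j

/-- **THE GENEALOGY OF A CHAIN** born at absolute step `j`: the bare birth `born 0 j` renewed successively at the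
absolute steps `j + a`, `a ∈ S` increasing (the dictionary's `renew G e h` places the event at step `h + 1`). [folklore] -/
def gen (j : ℕ) (S : Finset ℕ) : Gen ℕ := genN j S.card S

/-- the bare birth [folklore] -/
@[simp] theorem gen_empty (j : ℕ) : gen j ∅ = Gen.born 0 j := by
  simp [gen, genN]

/-- one renewal more: the genealogy of a non-empty history is the renewal of its truncation's [folklore] -/
theorem gen_of_nonempty (j : ℕ) {S : Finset ℕ} (h : S.Nonempty) :
    gen j S = Gen.renew (gen j (trunc S)) (topAge S) (j + topAge S - 1) := by
  rw [gen, gen, ← card_trunc_add_one h, genN, if_pos h]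

/-- **THE REACH OF A CHAIN'S GENEALOGY** is `j + topAge S + R` (rules (L1)/(L2) of the dictionary with the constant
window). [folklore] -/
theorem reach_gen (j R : ℕ) {S : Finset ℕ} (h1 : ∀ a ∈ S, 1 ≤ a) : (gen j S).reach (cW R) = j + topAge S + R := by
  by_cases h : S.Nonempty
  · rw [gen_of_nonempty j h, Gen.reach_renew]
    have := h1 _ (topAge_mem h)
    simp only [cW]; omega
  · rw [Finset.not_nonempty_iff_eq_empty.1 h]
    simp [cW]

/-- The GROVE of a history: its one genealogy. [folklore] -/
def cgrove (j : ℕ) (S : Finset ℕ) : Grove ℕ := {gen j S}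

/-- the grove reaches as far as the genealogy [folklore] -/
theorem mreach_cgrove (j R : ℕ) {S : Finset ℕ} (h1 : ∀ a ∈ S, 1 ≤ a) :
    mreach (cW R) (cgrove j S) = j + topAge S + R := by
  rw [cgrove, mreach_singleton, reach_gen j R h1]

/-- **A LINKED RENEWAL IS A LEDGER STEP**: the grove of a non-empty chain arises from its truncation's grove by ONE
`Step.renew` at absolute step `j + topAge S` — admissible because the chain is linked (`topAge S ≤ topAge (trunc S) + R`,
i.e. the renewal happens before the truncated genealogy's reach). [folklore] -/
theorem step_trunc {j R : ℕ} {S : Finset ℕ} (hne : S.Nonempty) (h1 : ∀ a ∈ S, 1 ≤ a) (hL : Linked R S) :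
    Step (cW R) (cgrove j (trunc S)) (topAge S) (j + topAge S) (cgrove j S) := by
  have htop : 1 ≤ topAge S := h1 _ (topAge_mem hne)
  have hh : j + topAge S - 1 < (gen j (trunc S)).reach (cW R) := by
    have h1' : ∀ a ∈ trunc S, 1 ≤ a := fun a ha => h1 a (Finset.mem_of_mem_erase ha)
    rw [reach_gen j R h1']
    have := hL.topAge_le hne
    omega
  have heq : j + topAge S = (j + topAge S - 1) + 1 := by omega
  rw [cgrove, cgrove, gen_of_nonempty j hne, heq]
  exact Step.renew hh

/-- … hence by the one-step script headed by the renewal event. [folklore] -/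
theorem script_trunc {j R : ℕ} {S : Finset ℕ} (hne : S.Nonempty) (h1 : ∀ a ∈ S, 1 ≤ a) (hL : Linked R S) :
    Script (cW R) (cgrove j (trunc S)) [(topAge S, j + topAge S)] (cgrove j S) :=
  Script.single (step_trunc hne h1 hL)

end Ledger


/-! ## §3 The chain forest on an insertion fibre and its `ForestDom` through `forestDom_of_grove_raw` -/

section Forest

variable {ι : Type*} [DecidableEq ι]

/-- **THE CHAIN FOREST** of one slot (window `R`, horizon `Ah`) realised inside a type of terms `ι` through an
embedding `emb` of histories with left inverse `hist` (`hist (emb S) = S`): components = the chains, root = the bare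
birth, age of the last event = the top age, truncation = the last renewal undone. [folklore] -/
def chainForest (R Ah : ℕ) (emb : Finset ℕ → ι) (hist : ι → Finset ℕ) (hhe : ∀ S, hist (emb S) = S) :
    EventForest ι where
  Cmp := (chains R Ah).image emb
  roots := {emb ∅}
  last c := topAge (hist c)
  parent c := emb (trunc (hist c))
  parent_mem c hc _ := by
    obtain ⟨S, hS, rfl⟩ := Finset.mem_image.1 hc
    rw [hhe]
    exact Finset.mem_image_of_mem _ (trunc_mem_chains hS)
  last_lt c hc hr := by
    obtain ⟨S, hS, rfl⟩ := Finset.mem_image.1 hc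
    rw [hhe, hhe]
    have hne : S.Nonempty := by
      rw [Finset.nonempty_iff_ne_empty]
      rintro rfl
      exact hr (Finset.mem_singleton_self _)
    exact topAge_trunc_lt hne (one_le_of_mem_chains hS)

/-- The MULTIPLICATIVE CHAIN PRICE: `p₀` for the birth, `p` per renewal. [folklore] -/
def chainPrice (p₀ p : ℝ) (S : Finset ℕ) : ℝ := p₀ * p ^ S.card

/-- chain prices are non-negative for non-negative `p₀`, `p` [folklore] -/
theorem chainPrice_nonneg {p₀ p : ℝ} (hp₀ : 0 ≤ p₀) (hp : 0 ≤ p) (S : Finset ℕ) : 0 ≤ chainPrice p₀ p S :=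
  mul_nonneg hp₀ (pow_nonneg hp _)

/-- one renewal more costs exactly the factor `p` [folklore] -/
theorem chainPrice_eq_mul_trunc (p₀ p : ℝ) {S : Finset ℕ} (h : S.Nonempty) :
    chainPrice p₀ p S = p * chainPrice p₀ p (trunc S) := by
  rw [chainPrice, chainPrice, ← card_trunc_add_one h, pow_succ]
  ring

/-- **THE MULTIPLICATIVE RENEWAL-CHAIN MODEL INHABITS `ForestDom` THROUGH THE LINEAGE'S RAW CONSTRUCTOR.**  On the
pending class `emb '' pendChains R Ah` with weights `w (emb S) ≤ p₀·p^{#S}·a₀` relative to a context weight `a₀ ≥ 0`,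
tilts `1 ≤ z < z₁`, prices `p₀, p ≥ 0`, any root budget `B₀ ≥ p₀·z₁^R` and any defect `η` with
`p·z₁^R·((z/z₁)/(1 − z/z₁)) ≤ 1 − η`:  `ForestDom Pend w a₀ Ah z η B₀ (1/(1 − z₁⁻¹z))` — by
`T4PersistenceGrove.forestDom_of_grove_raw` on the chain forest with the ledger realisation of §2 (every edge ONE
`Step.renew`, own booking `R`, no tail), one shape, catalogue price `p·z₁^R`, and the two raw clauses (E2-rel-raw)
`hraw₀`, (PR-raw) `hraw` holding WITH EQUALITY (`chainPrice_eq_mul_trunc`). [folklore] -/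
theorem forestDom_chains (emb : Finset ℕ → ι) (hist : ι → Finset ℕ) (hhe : ∀ S, hist (emb S) = S)
    {R Ah : ℕ} (j : ℕ) {a₀ p₀ p z z₁ η B₀ : ℝ} (w : ι → ℝ)
    (hz : 1 ≤ z) (hzz : z < z₁) (ha₀ : 0 ≤ a₀) (hp₀ : 0 ≤ p₀) (hp : 0 ≤ p)
    (hB₀ : p₀ * z₁ ^ R ≤ B₀) (hη : p * z₁ ^ R * ((z / z₁) / (1 - z / z₁)) ≤ 1 - η)
    (hw : ∀ S ∈ pendChains R Ah, w (emb S) ≤ chainPrice p₀ p S * a₀) :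
    ForestDom ((pendChains R Ah).image emb) w a₀ Ah z η B₀ (1 / (1 - z₁⁻¹ * z)) := by
  have hz₁ : 0 ≤ z₁ := le_trans (le_trans zero_le_one hz) hzz.le
  have hB₀' : 0 ≤ B₀ := le_trans (mul_nonneg hp₀ (pow_nonneg hz₁ _)) hB₀
  -- membership bookkeeping on the image
  have hCmp : ∀ c ∈ (chainForest R Ah emb hist hhe).Cmp, ∃ S ∈ chains R Ah, emb S = c := fun c hc =>
    Finset.mem_image.1 hc
  have hroots : ∀ S, emb S ∈ (chainForest R Ah emb hist hhe).roots ↔ S = ∅ := by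
    intro S
    change emb S ∈ ({emb ∅} : Finset ι) ↔ S = ∅
    rw [Finset.mem_singleton]
    exact ⟨fun h => by simpa [hhe] using congrArg hist h, fun h => by rw [h]⟩
  have hne : ∀ S, emb S ∉ (chainForest R Ah emb hist hhe).roots → S.Nonempty := fun S h =>
    Finset.nonempty_iff_ne_empty.2 fun h' => h ((hroots S).2 h')
  refine forestDom_of_grove_raw (Sh := Unit) (ε := ℕ) (chainForest R Ah emb hist hhe)
    (fun c => chainPrice p₀ p (hist c) * a₀) (fun _ => ()) (fun c => if hist c = ∅ then p₀ else p)
    (fun _ _ _ => p * z₁ ^ R) (fun _ _ => {()}) (cW R) j (fun c => cgrove j (hist c)) (fun c => topAge (hist c))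
    (fun _ => []) hz hzz (mul_nonneg hp (pow_nonneg hz₁ _)) ha₀ hB₀'
    (Finset.image_subset_image (pendChains_subset R Ah)) ?_ ?_ (by linarith) ?_ ?_ ?_ ?_ ?_ ?_ ?_ ?_ ?_ ?_ ?_ ?_
  · -- ages within the horizon
    intro c hc
    obtain ⟨S, hS, rfl⟩ := hCmp c hc
    change topAge (hist (emb S)) ≤ Ah
    rw [hhe]; exact topAge_le_of_mem_chains hS
  · -- non-negative majorant
    intro c _
    exact mul_nonneg (chainPrice_nonneg hp₀ hp _) ha₀
  · -- LEDGER, roots: the bare birth at step `j`, no tail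
    intro c hc hr
    obtain ⟨S, hS, rfl⟩ := hCmp c hc
    have hS0 : S = ∅ := (hroots S).1 hr
    subst hS0
    refine ⟨by change topAge (hist (emb ∅)) = 0; rw [hhe, topAge_empty], ?_⟩
    rw [hhe, topAge_empty, cgrove, gen_empty]
    exact Script.nil _
  · -- (E2-rel-raw) WITH EQUALITY
    intro c hc hr
    obtain ⟨S, hS, rfl⟩ := hCmp c hc
    have hS0 : S = ∅ := (hroots S).1 hr
    subst hS0
    simp [hhe, chainPrice]
  · -- root pairing mass `p₀·z₁^R ≤ B₀`
    have hset : ((chainForest R Ah emb hist hhe).Cmp.filter fun c => c ∈ (chainForest R Ah emb hist hhe).roots) =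
        {emb ∅} := by
      ext c
      simp only [Finset.mem_filter, Finset.mem_singleton]
      constructor
      · rintro ⟨-, h⟩; exact Finset.mem_singleton.1 h
      · rintro rfl
        exact ⟨Finset.mem_image_of_mem _ (empty_mem_chains R Ah), Finset.mem_singleton_self _⟩
    rw [hset, Finset.sum_singleton]
    simpa [hhe, booking, cW] using hB₀
  · -- (SH) injective shapes: a child is its parent with its own top age re-inserted
    intro c₁ hc₁ c₂ hc₂ hr₁ hr₂ hpar hlast _
    obtain ⟨S₁, hS₁, rfl⟩ := hCmp c₁ hc₁
    obtain ⟨S₂, hS₂, rfl⟩ := hCmp c₂ hc₂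
    have h₁ := hne S₁ hr₁
    have h₂ := hne S₂ hr₂
    change emb (trunc (hist (emb S₁))) = emb (trunc (hist (emb S₂))) at hpar
    change topAge (hist (emb S₁)) = topAge (hist (emb S₂)) at hlast
    rw [hhe, hhe] at hpar hlast
    have htr : trunc S₁ = trunc S₂ := by simpa [hhe] using congrArg hist hpar
    rw [← insert_trunc h₁, ← insert_trunc h₂, htr, hlast]
  · -- shapes in the catalogue
    intro c _ _; exact Finset.mem_singleton_self _
  · -- catalogue prices non-negative
    intro s _ ℓ σ _; exact mul_nonneg hp (pow_nonneg hz₁ _)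
  · -- LEDGER, edges: one `Step.renew`
    intro c hc hr
    obtain ⟨S, hS, rfl⟩ := hCmp c hc
    have h := hne S hr
    change Script (cW R) (cgrove j (hist (emb (trunc (hist (emb S))))))
      ((topAge (hist (emb S)), j + topAge (hist (emb S))) :: []) (cgrove j (hist (emb S)))
    rw [hhe, hhe]
    exact script_trunc h (one_le_of_mem_chains hS) (mem_chains.1 hS).2
  · -- (PR-raw) WITH EQUALITY
    intro c hc hr
    obtain ⟨S, hS, rfl⟩ := hCmp c hc
    have h := hne S hr
    change chainPrice p₀ p (hist (emb S)) * a₀ ≤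
      (if hist (emb S) = ∅ then p₀ else p) * (chainPrice p₀ p (hist (emb (trunc (hist (emb S))))) * a₀)
    rw [hhe, hhe, if_neg (Finset.nonempty_iff_ne_empty.1 h), chainPrice_eq_mul_trunc p₀ p h]
    exact le_of_eq (by ring)
  · -- (PAIR) own booking `R` against the catalogue price, WITH EQUALITY
    intro c hc hr
    obtain ⟨S, hS, rfl⟩ := hCmp c hc
    have h := hne S hr
    simp [hhe, booking, cW, if_neg (Finset.nonempty_iff_ne_empty.1 h)]
  · -- (ENT) the one-shape catalogue
    intro s _ ℓ; simp
  · -- PENDING: the grove reaches beyond the horizon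
    intro c hc
    obtain ⟨S, hS, rfl⟩ := Finset.mem_image.1 hc
    obtain ⟨hSc, hpend⟩ := mem_pendChains.1 hS
    rw [hhe, mreach_cgrove j R (one_le_of_mem_chains hSc)]
    omega
  · -- actual weights under the majorant
    intro c hc
    obtain ⟨S, hS, rfl⟩ := Finset.mem_image.1 hc
    simpa [hhe] using hw S hS

end Forest


/-! ## §4 The run: persistent slots, the option-product switch-off structure, `EventDom` inhabited, the row's output -/

section Run

variable {N : ℕ}

/-- The OLD-STEP THRESHOLD of the model: `j⋆(K) = ⌊K/2⌋` (half of the steps are old). [folklore] -/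
def jhalf (K : ℕ) : ℕ := K / 2

/-- The number of slots ALIVE at cutoff `K`: slot `i` (birth scale `i`) is alive iff `i < j⋆(K)`, at most `N`. [folklore] -/
def nsl (N K : ℕ) : ℕ := min N (jhalf K)

/-- the coordinate of the `i`-th alive slot [folklore] -/
def slot {N K : ℕ} (i : Fin (nsl N K)) : Fin N := ⟨i, lt_of_lt_of_le i.2 (min_le_left _ _)⟩

/-- distinct alive slots have distinct coordinates [folklore] -/
theorem slot_injective {N K : ℕ} : Function.Injective (slot (N := N) (K := K)) := fun i i' h =>
  Fin.ext (by simpa [slot] using congrArg Fin.val h)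

/-- an alive slot is born at an old step [folklore] -/
theorem slot_lt_jhalf {N K : ℕ} (i : Fin (nsl N K)) : (i : ℕ) < jhalf K := lt_of_lt_of_le i.2 (min_le_right _ _)

/-- **THE ADMISSIBLE VALUES OF A COORDINATE** at cutoff `K`: `none` (no pending component anchored there) or, for an
alive slot `k < j⋆(K)`, a PENDING renewal chain with horizon `K − k`. [folklore] -/
def slotVals (R K : ℕ) (k : Fin N) : Finset (Option (Finset ℕ)) :=
  if (k : ℕ) < jhalf K then insert none ((pendChains R (K - k)).image some) else {none}

/-- `none` is always admissible [folklore] -/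
theorem none_mem_slotVals (R K : ℕ) (k : Fin N) : none ∈ slotVals R K k := by
  unfold slotVals; split_ifs <;> simp

/-- a pending chain is admissible at an alive slot [folklore] -/
theorem some_mem_slotVals {R K : ℕ} {k : Fin N} (hk : (k : ℕ) < jhalf K) {S : Finset ℕ}
    (hS : S ∈ pendChains R (K - k)) : some S ∈ slotVals R K k := by
  rw [slotVals, if_pos hk]
  exact Finset.mem_insert_of_mem (Finset.mem_image_of_mem _ hS)

/-- … and conversely [folklore] -/
theorem mem_pendChains_of_some_mem {R K : ℕ} {k : Fin N} {S : Finset ℕ} (h : some S ∈ slotVals R K k) :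
    S ∈ pendChains R (K - k) := by
  unfold slotVals at h
  split_ifs at h
  · rcases Finset.mem_insert.1 h with h | h
    · exact absurd h (Option.some_ne_none S)
    · obtain ⟨S', hS', he⟩ := Finset.mem_image.1 h
      cases he; exact hS'
  · exact absurd (Finset.mem_singleton.1 h) (Option.some_ne_none S)

/-- **THE TERM FAMILY OF THE RUN AT CUTOFF `K`**: assignments of admissible values to the `N` coordinates. [folklore] -/
def terms (N R K : ℕ) : Finset (Fin N → Option (Finset ℕ)) := Fintype.piFinset (slotVals R K)

/-- membership in the term family [folklore] -/
theorem mem_terms {R K : ℕ} {τ : Fin N → Option (Finset ℕ)} : τ ∈ terms N R K ↔ ∀ k, τ k ∈ slotVals R K k :=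
  Fintype.mem_piFinset

/-- **THE OPTION-PRODUCT SWITCH-OFF STRUCTURE**: slot `i` is pending on `τ` iff its coordinate carries a chain;
switching it off forgets the chain. [folklore] -/
def runSwitchOff (N R K : ℕ) : SwitchOff (terms N R K) (nsl N K) where
  pend i τ := (τ (slot i)).isSome
  off i τ := Function.update τ (slot i) none
  off_mem i τ hτ := by
    rw [mem_terms] at hτ ⊢
    intro k
    by_cases hk : k = slot i
    · subst hk; rw [Function.update_self]; exact none_mem_slotVals R K _
    · rw [Function.update_of_ne hk]; exact hτ k
  pend_off_self i τ := by simp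
  pend_off_ne i i' τ h := by
    have : slot i' ≠ slot i := fun e => h (slot_injective e)
    simp [Function.update_of_ne this]
  off_of_pend i τ h := by
    have h' : τ (slot i) = none := Option.not_isSome_iff_eq_none.1 (by simp [h])
    rw [← h']
    exact Function.update_eq_self _ τ

/-- The factor of one coordinate: `1` if empty, the chain price if it carries a chain. [folklore] -/
def optPrice (p₀ p : ℝ) : Option (Finset ℕ) → ℝ
  | none => 1
  | some S => chainPrice p₀ p S

/-- coordinate factors are non-negative [folklore] -/
theorem optPrice_nonneg {p₀ p : ℝ} (hp₀ : 0 ≤ p₀) (hp : 0 ≤ p) : ∀ o, 0 ≤ optPrice p₀ p o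
  | none => zero_le_one
  | some S => chainPrice_nonneg hp₀ hp S

/-- **THE MULTIPLICATIVE WEIGHTS OF THE RUN**: amplitude `a K` times the product of the coordinate factors (the same at
every `t`). [folklore] -/
def runWeight (a : ℕ → ℝ) (p₀ p : ℝ) (K : ℕ) (τ : Fin N → Option (Finset ℕ)) : ℝ :=
  a K * ∏ k, optPrice p₀ p (τ k)

/-- run weights are non-negative [folklore] -/
theorem runWeight_nonneg {a : ℕ → ℝ} {p₀ p : ℝ} (ha : ∀ K, 0 ≤ a K) (hp₀ : 0 ≤ p₀) (hp : 0 ≤ p) (K : ℕ)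
    (τ : Fin N → Option (Finset ℕ)) : 0 ≤ runWeight a p₀ p K τ :=
  mul_nonneg (ha K) (Finset.prod_nonneg fun k _ => optPrice_nonneg hp₀ hp (τ k))

/-- inserting a chain at an empty coordinate multiplies the weight by the chain price [folklore] -/
theorem runWeight_update_some {a : ℕ → ℝ} {p₀ p : ℝ} {K : ℕ} {τ : Fin N → Option (Finset ℕ)} {k : Fin N}
    (hk : τ k = none) (S : Finset ℕ) :
    runWeight a p₀ p K (Function.update τ k (some S)) = chainPrice p₀ p S * runWeight a p₀ p K τ := by
  unfold runWeight
  rw [← Finset.mul_prod_erase Finset.univ _ (Finset.mem_univ k),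
    ← Finset.mul_prod_erase Finset.univ (fun k' => optPrice p₀ p (τ k')) (Finset.mem_univ k)]
  have : ∏ k' ∈ Finset.univ.erase k, optPrice p₀ p (Function.update τ k (some S) k') =
      ∏ k' ∈ Finset.univ.erase k, optPrice p₀ p (τ k') :=
    Finset.prod_congr rfl fun k' hk' => by rw [Function.update_of_ne (Finset.ne_of_mem_erase hk')]
  rw [this, Function.update_self, hk]
  simp only [optPrice]
  ring

/-- **(E2-rel-raw) IN THE MODEL, WITH EQUALITY**: inserting the bare birth at an empty coordinate costs exactly the
factor `p₀` relative to the context weight. [folklore] -/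
theorem runWeight_raw_root {a : ℕ → ℝ} {p₀ p : ℝ} {K : ℕ} {τ : Fin N → Option (Finset ℕ)} {k : Fin N}
    (hk : τ k = none) : runWeight a p₀ p K (Function.update τ k (some ∅)) = p₀ * runWeight a p₀ p K τ := by
  rw [runWeight_update_some hk, chainPrice, Finset.card_empty, pow_zero, mul_one]

/-- **(PR-raw) IN THE MODEL, WITH EQUALITY**: one renewal more costs exactly the factor `p` relative to the truncated
history in the same context. [folklore] -/
theorem runWeight_raw_step {a : ℕ → ℝ} {p₀ p : ℝ} {K : ℕ} {τ : Fin N → Option (Finset ℕ)} {k : Fin N}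
    (hk : τ k = none) {S : Finset ℕ} (hS : S.Nonempty) :
    runWeight a p₀ p K (Function.update τ k (some S)) =
      p * runWeight a p₀ p K (Function.update τ k (some (trunc S))) := by
  rw [runWeight_update_some hk, runWeight_update_some hk, chainPrice_eq_mul_trunc p₀ p hS, mul_assoc]

/-- **THE INSERTION FIBRE IS THE SET OF PENDING CHAINS**: over a context `τ″ ∈ terms` with coordinate `slot i` empty,
the terms pending at slot `i` that switch off to `τ″` are exactly `τ″` with a pending chain inserted there. [folklore] -/
theorem fibre_eq {R K : ℕ} (i : Fin (nsl N K)) {τ'' : Fin N → Option (Finset ℕ)} (hτ'' : τ'' ∈ terms N R K)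
    (hp : (runSwitchOff N R K).pend i τ'' = false) :
    ((terms N R K).filter fun τ => (runSwitchOff N R K).pend i τ = true ∧ (runSwitchOff N R K).off i τ = τ'') =
      (pendChains R (K - (slot i : ℕ))).image fun S => Function.update τ'' (slot i) (some S) := by
  have hnone : τ'' (slot i) = none := Option.not_isSome_iff_eq_none.1 (by simp [runSwitchOff] at hp; simp [hp])
  ext τ
  simp only [Finset.mem_filter, Finset.mem_image, runSwitchOff]
  constructor
  · rintro ⟨hτ, hsome, hoff⟩
    obtain ⟨S, hS⟩ := Option.isSome_iff_exists.1 hsome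
    refine ⟨S, ?_, ?_⟩
    · have := mem_terms.1 hτ (slot i)
      rw [hS] at this
      exact mem_pendChains_of_some_mem this
    · rw [← hoff, Function.update_idem, ← hS, Function.update_eq_self]
  · rintro ⟨S, hS, rfl⟩
    refine ⟨?_, by simp, ?_⟩
    · rw [mem_terms] at hτ'' ⊢
      intro k
      by_cases hk : k = slot i
      · subst hk; rw [Function.update_self]; exact some_mem_slotVals (slot_lt_jhalf i) hS
      · rw [Function.update_of_ne hk]; exact hτ'' k
    · rw [Function.update_idem, ← hnone, Function.update_eq_self]

/-- **`EventDom` IS INHABITED, K-UNIFORMLY, BY THE MULTIPLICATIVE RENEWAL-CHAIN MODEL.**  Terms `terms N R`, weights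
`runWeight a p₀ p` (amplitude `a ≥ 0`, prices `p₀, p ≥ 0`), bad class = the terms with a pending slot, old-step threshold
`j⋆(K) = ⌊K/2⌋`, R4 count `V = 1` at any `Λ ≥ 1`, tilts `1 ≤ z < z₁`, any root budget `B₀ ≥ p₀·z₁^R` and defect `η` with
`p·z₁^R·((z/z₁)/(1 − z/z₁)) ≤ 1 − η`, terminal constant `D = 1/(1 − z₁⁻¹z)`:
`EventDom l₀ (terms N R) (runWeight a p₀ p) Bad z η B₀ D 1 Λ j⋆` — per `(K, t)` the switch-off structure `runSwitchOff`,
birth scales `j i = i`, and on every insertion fibre `forestDom_chains` relative to the context weight. [folklore] -/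
theorem eventDom_run (N R : ℕ) (l₀ : ℝ) (a : ℕ → ℝ) {p₀ p z z₁ η B₀ Λ : ℝ} (ha : ∀ K, 0 ≤ a K)
    (hz : 1 ≤ z) (hzz : z < z₁) (hp₀ : 0 ≤ p₀) (hp : 0 ≤ p) (hΛ : 1 ≤ Λ)
    (hB₀ : p₀ * z₁ ^ R ≤ B₀) (hη : p * z₁ ^ R * ((z / z₁) / (1 - z / z₁)) ≤ 1 - η) :
    EventDom l₀ (terms N R) (fun K _ τ => runWeight a p₀ p K τ) (fun K _ => (runSwitchOff N R K).bad)
      z η B₀ (1 / (1 - z₁⁻¹ * z)) 1 Λ jhalf where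
  dom K t _ := by
    refine ⟨nsl N K, runSwitchOff N R K, fun i => (slot i : ℕ), rfl, fun i => slot_lt_jhalf i, ?_, ?_⟩
    · -- R4 count: one slot per birth scale
      intro j₀ _
      have hcard : ((Finset.univ : Finset (Fin (nsl N K))).filter fun i => (slot i : ℕ) = j₀).card ≤ 1 :=
        Finset.card_le_one.2 fun i hi i' hi' => Fin.ext (by
          have h₁ := (Finset.mem_filter.1 hi).2
          have h₂ := (Finset.mem_filter.1 hi').2
          simp only [slot] at h₁ h₂
          omega)
      calc (((Finset.univ : Finset (Fin (nsl N K))).filter fun i => (slot i : ℕ) = j₀).card : ℝ) ≤ 1 := by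
            exact_mod_cast hcard
        _ = 1 * 1 := (one_mul _).symm
        _ ≤ 1 * Λ ^ (K - j₀) := mul_le_mul_of_nonneg_left (one_le_pow₀ hΛ) zero_le_one
    · -- every insertion fibre: the chain forest relative to the context weight
      intro i τ'' hτ'' hpend
      rw [fibre_eq i hτ'' hpend]
      have hnone : τ'' (slot i) = none :=
        Option.not_isSome_iff_eq_none.1 (by simp [runSwitchOff] at hpend; simp [hpend])
      exact forestDom_chains (fun S => Function.update τ'' (slot i) (some S)) (fun τ => (τ (slot i)).getD ∅)
        (fun S => by simp) (slot i : ℕ) (runWeight a p₀ p K) hz hzz (runWeight_nonneg ha hp₀ hp K τ'') hp₀ hp hB₀ hη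
        (fun S _ => (runWeight_update_some hnone S).le)

/-- the model's half-step threshold leaves a positive fraction of old steps [folklore] -/
theorem half_le_sub_jhalf (K : ℕ) : (1 / 2 : ℝ) * K ≤ ((K - jhalf K : ℕ) : ℝ) := by
  have h1 : jhalf K ≤ K := Nat.div_le_self K 2
  have h2 : ((jhalf K : ℕ) : ℝ) ≤ (K : ℝ) / 2 := by unfold jhalf; exact Nat.cast_div_le
  push_cast [Nat.cast_sub h1]
  linarith

/-- **THE ROW'S OUTPUT SHAPE ON THE MODEL, END TO END**: two multiplicative runs on the same term family (prices
`(p₀, p)` and `(q₀, q)`, amplitudes `a, b ≥ 0`) under a common root budget `B₀` and a common POSITIVE defect `η` — the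
model's PAIRING CONDITION `max(p, q)·z₁^R·(z/z₁)/(1 − z/z₁) < 1` — at tilts `Λ < z < z₁`, `1 ≤ z`, `1 ≤ Λ` (the RATE
CONDITION), give `T4WeightBudget.RelWeightBound` with the explicit profile of `relWeightBound_of_eventDom`:
`W K = 1 − exp(−(B₀·D/η)·((Λz⁻¹)^{K − ⌊K/2⌋ + 1}/(1 − Λz⁻¹)))`, `D = 1/(1 − z₁⁻¹z)`.  The lineage's chain
Grove ledger → `forestDom_of_grove_raw` → `EventDom` → `FibreRate` → `RelWeightBound` thus runs with every carrier
inhabited and every constant explicit; nothing of [Balaban1989LargeFieldII] is involved. [folklore] -/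
theorem relWeightBound_run (N R : ℕ) (l₀ : ℝ) (a b : ℕ → ℝ) {p₀ p q₀ q z z₁ η B₀ Λ : ℝ}
    (ha : ∀ K, 0 ≤ a K) (hb : ∀ K, 0 ≤ b K) (hz : 1 ≤ z) (hzz : z < z₁) (hΛ : 1 ≤ Λ) (hΛz : Λ < z)
    (hp₀ : 0 ≤ p₀) (hp : 0 ≤ p) (hq₀ : 0 ≤ q₀) (hq : 0 ≤ q) (hη0 : 0 < η)
    (hB₀p : p₀ * z₁ ^ R ≤ B₀) (hB₀q : q₀ * z₁ ^ R ≤ B₀)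
    (hηp : p * z₁ ^ R * ((z / z₁) / (1 - z / z₁)) ≤ 1 - η) (hηq : q * z₁ ^ R * ((z / z₁) / (1 - z / z₁)) ≤ 1 - η) :
    RelWeightBound l₀ (terms N R) (fun K _ τ => runWeight a p₀ p K τ) (fun K _ τ => runWeight b q₀ q K τ)
      (fun K _ => (runSwitchOff N R K).bad) fun K =>
        1 - Real.exp (-(B₀ * (1 / (1 - z₁⁻¹ * z)) / η * 1 *
          ((Λ * z⁻¹) ^ (K - jhalf K + 1) / (1 - Λ * z⁻¹)))) := by
  have hz₁ : 0 < z₁ := lt_of_lt_of_le (lt_of_lt_of_le one_pos hz) hzz.le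
  have hD : 0 ≤ 1 / (1 - z₁⁻¹ * z) := by
    refine div_nonneg zero_le_one (sub_nonneg.2 ?_)
    rw [inv_mul_le_iff₀ hz₁]; simpa using hzz.le
  have hB₀ : 0 ≤ B₀ := le_trans (mul_nonneg hp₀ (pow_nonneg hz₁.le _)) hB₀p
  exact relWeightBound_of_eventDom hη0 hB₀ hD zero_le_one (lt_of_lt_of_le one_pos hΛ) hΛz one_half_pos
    (fun K => Nat.div_le_self K 2) half_le_sub_jhalf
    (fun K _ _ τ _ => runWeight_nonneg ha hp₀ hp K τ) (fun K _ _ τ _ => runWeight_nonneg hb hq₀ hq K τ)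
    (eventDom_run N R l₀ a ha hz hzz hp₀ hp hΛ hB₀p hηp) (eventDom_run N R l₀ b hb hz hzz hq₀ hq hΛ hB₀q hηq)

end Run


/-! ## §5 Sanity, decided: a small chain census and one numerical instance of every hypothesis at once -/

section Sanity

/-- window `2`, horizon `3`: the seven chains -/
example : chains 2 3 = {∅, {1}, {2}, {1, 2}, {1, 3}, {2, 3}, {1, 2, 3}} := by decide

/-- … of which five are still pending at the horizon (`3 < topAge + 2`) -/
example : pendChains 2 3 = {{2}, {1, 2}, {1, 3}, {2, 3}, {1, 2, 3}} := by decide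

/-- `{3}` is not a chain: the renewal at age `3` comes `3 > 2` steps after the birth -/
example : ¬ Linked 2 {3} := by decide

/-- window `1` (the smallest model window; no printed status is claimed — B16 p. 361's «N ≤ R_k» is an assumption recorded
while bounding the third-order term of (1.20), cell reading: compatible with the B15 p. 198 window; v1.0.1, GAPS G-t4r2-17):
the only way to be pending at horizon `4` is to renew at EVERY step -/
example : pendChains 1 4 = {{1, 2, 3, 4}} := by decide

/-- **EVERY HYPOTHESIS OF `relWeightBound_run` AT ONCE**: `Λ = 2 < z = 4 < z₁ = 8`, window `R = 1`, all four prices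
`1/64`, `B₀ = 1/8`, `η = 7/8` (pairing: `(1/64)·8·((4/8)/(1 − 4/8)) = 1/8 = 1 − η`), any number of slots `N`. -/
example (N : ℕ) (l₀ : ℝ) :
    RelWeightBound l₀ (terms N 1) (fun K _ τ => runWeight (fun _ => 1) (1 / 64) (1 / 64) K τ)
      (fun K _ τ => runWeight (fun _ => 1) (1 / 64) (1 / 64) K τ) (fun K _ => (runSwitchOff N 1 K).bad) fun K =>
        1 - Real.exp (-((1 / 8 : ℝ) * (1 / (1 - (8 : ℝ)⁻¹ * 4)) / (7 / 8) * 1 *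
          ((2 * (4 : ℝ)⁻¹) ^ (K - jhalf K + 1) / (1 - 2 * (4 : ℝ)⁻¹)))) :=
  relWeightBound_run N 1 l₀ (fun _ => 1) (fun _ => 1) (fun _ => zero_le_one) (fun _ => zero_le_one)
    (by norm_num) (by norm_num) (by norm_num) (by norm_num) (by norm_num) (by norm_num) (by norm_num) (by norm_num)
    (by norm_num) (by norm_num) (by norm_num) (by norm_num) (by norm_num)

end Sanity

end Literature.MathematicalPhysics.QuantumFieldTheory.Balaban1983to89.T4RenewalChains
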